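import Mathlib

/-!
# Zeta5Search / Elimination / LatticeSandwich — the lattice (Siegel-type) elimination road is downstream of the goal

HONEST FRAMING: systematic search; no irrationality claim unless certified. This file makes NO claim about
`ζ(5)`; it is the kernel-checked half of a NEGATIVE result (cell pub-zeta5, fam-elim `FAMILY.md` §15.9).

Setting (as in `LatticeCriterion.lean`): three linear forms `r i = u i * ξ + w i * η + v i` (`i : Fin 3`) with
rational coefficient vectors `u, w, v` of rank 3. An integer relation `α` with `α·w = 0`, `α·u = A ∈ ℤ`,
`α·v = B ∈ ℤ` eliminates the parasitic period `η` and yields the integer pair `(A, B)` with `A ξ + B = α·r`.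
The 'lattice road' needs such relations to be SHORT (balance hypothesis `H`). This file shows that shortness is
controlled by the Diophantine approximation properties of `ξ` alone:

* `pair_of_short_relation`: if `|α i| ≤ H`, `|u i - lam * w i| ≤ U` (ALIGNMENT of the `ξ`- and `η`-coefficient
  vectors) and `|r i| ≤ R`, then `|A| ≤ 3 H U` and `|A ξ + B| ≤ 3 H R`.
* `pair_fst_ne_zero`: by rank 3, `A ≠ 0` as soon as `|A ξ + B| < 1`.
* `no_short_relation_of_measure`: if `ξ` satisfies the irrationality-measure inequality
  `C * |A| ^ (1 - κ) ≤ |A ξ + B|` for all integers `A ≠ 0`, `B` (i.e. `|ξ - P/Q| ≥ C / Q ^ κ`), then NO nonzero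
  integral relation of height `≤ H` exists once `3 H R < 1` and `3 H R < C (3 H U) ^ (1 - κ)`;
  `relation_height_gt_of_measure` is the same statement as a lower bound for the height.

Consequence (FAMILY.md §15.9; the rates below are MEASURED there exactly at finite `n` — as asymptotic rates they
are unproved Laplace-method / Poincaré–Perron material, not in the tree): with `H = e^{τ n}`, `U = e^{u⊥ n}`,
`R = e^{-c n}` the condition reads `κ < 1 + (c - τ)/(τ + u⊥)`. For the Brown–Zudilin record module
(`c = 86.2`, `u⊥ = 30.3`) at the weakest useful scale `τ* = 18.8` this is `κ < 2.37`. Hence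
  `[ζ(5) irrational with μ(ζ(5)) < 2.37] ⟹ H(τ*) for all large n ⟹ ζ(5) irrational`
(the second implication is `LatticeCriterion.irrational_of_lattice_elimination` plus Minkowski's second
theorem): the open input of the lattice road is a Diophantine property of `ζ(5)` sandwiched between
irrationality and an irrationality measure — downstream of the goal, not a property of the hypergeometric
construction that could be established independently. The road is closed; this file is the certificate.
-/

namespace Summit.KontsevichZagierPeriods.Zeta5Search.Elimination

open Finset BigOperators

/-- Triangle inequality for a three-term dot product: `|Σ a i * b i| ≤ 3 * H * M` when `|a i| ≤ H`, `|b i| ≤ M`. -/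
theorem abs_sum_mul_le_three (a b : Fin 3 → ℝ) (H M : ℝ) (ha : ∀ i, |a i| ≤ H) (hb : ∀ i, |b i| ≤ M) :
    |∑ i, a i * b i| ≤ 3 * H * M := by
  calc |∑ i, a i * b i| ≤ ∑ i, |a i * b i| := Finset.abs_sum_le_sum_abs _ _
    _ ≤ ∑ _i : Fin 3, H * M := by
        apply Finset.sum_le_sum
        intro i _
        rw [abs_mul]
        have hH : 0 ≤ H := le_trans (abs_nonneg _) (ha i)
        exact mul_le_mul (ha i) (hb i) (abs_nonneg _) hH
    _ = 3 * H * M := by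
        simp only [Finset.sum_const, Finset.card_univ, Fintype.card_fin, nsmul_eq_mul, Nat.cast_ofNat]
        ring

/-- THE LEMMA. A relation `α ⊥ w` of height `≤ H` with integral pair `(A, B) = (α·u, α·v)` gives
`|A| ≤ 3 H U` (alignment bound: only the component of `u` transversal to `w` is seen by `α`) and
`|A ξ + B| = |α·r| ≤ 3 H R`. -/
theorem pair_of_short_relation (ξ η : ℝ) (u w v : Fin 3 → ℚ) (r : Fin 3 → ℝ)
    (hr : ∀ i, r i = (u i : ℝ) * ξ + (w i : ℝ) * η + (v i : ℝ))
    (α : Fin 3 → ℤ) (hαw : ∑ i, (α i : ℚ) * w i = 0)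
    (A B : ℤ) (hA : (A : ℚ) = ∑ i, (α i : ℚ) * u i) (hB : (B : ℚ) = ∑ i, (α i : ℚ) * v i)
    (lam U R H : ℝ) (hH : ∀ i, |(α i : ℝ)| ≤ H)
    (hU : ∀ i, |(u i : ℝ) - lam * (w i : ℝ)| ≤ U) (hR : ∀ i, |r i| ≤ R) :
    |(A : ℝ)| ≤ 3 * H * U ∧ |(A : ℝ) * ξ + (B : ℝ)| ≤ 3 * H * R := by
  have hAr : (A : ℝ) = ∑ i, (α i : ℝ) * (u i : ℝ) := by
    have h := congrArg (fun x : ℚ => (x : ℝ)) hA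
    push_cast at h
    exact h
  have hBr : (B : ℝ) = ∑ i, (α i : ℝ) * (v i : ℝ) := by
    have h := congrArg (fun x : ℚ => (x : ℝ)) hB
    push_cast at h
    exact h
  have hwr : ∑ i, (α i : ℝ) * (w i : ℝ) = 0 := by
    have h := congrArg (fun x : ℚ => (x : ℝ)) hαw
    push_cast at h
    exact h
  refine ⟨?_, ?_⟩
  · have key : (A : ℝ) = ∑ i, (α i : ℝ) * ((u i : ℝ) - lam * (w i : ℝ)) := by
      rw [hAr]
      simp only [Fin.sum_univ_three] at hwr ⊢
      linear_combination lam * hwr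
    rw [key]
    exact abs_sum_mul_le_three _ _ H U hH hU
  · have key : (A : ℝ) * ξ + (B : ℝ) = ∑ i, (α i : ℝ) * r i := by
      rw [hAr, hBr]
      simp only [Fin.sum_univ_three] at hwr ⊢
      rw [hr 0, hr 1, hr 2]
      linear_combination (-η) * hwr
    rw [key]
    exact abs_sum_mul_le_three _ _ H R hH hR

/-- Rank 3 forces `A ≠ 0` once the eliminated form is `< 1` in absolute value: otherwise `B = 0` too and
`α` would be a rational relation among all three coefficient vectors. -/
theorem pair_fst_ne_zero (u w v : Fin 3 → ℚ)
    (hrank : ∀ a : Fin 3 → ℚ, ∑ i, a i * u i = 0 → ∑ i, a i * w i = 0 → ∑ i, a i * v i = 0 → a = 0)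
    (α : Fin 3 → ℤ) (hα : α ≠ 0) (hαw : ∑ i, (α i : ℚ) * w i = 0)
    (A B : ℤ) (hA : (A : ℚ) = ∑ i, (α i : ℚ) * u i) (hB : (B : ℚ) = ∑ i, (α i : ℚ) * v i)
    (ξ : ℝ) (hsmall : |(A : ℝ) * ξ + (B : ℝ)| < 1) : A ≠ 0 := by
  intro hA0
  have hB0 : B = 0 := by
    have h1 : |(B : ℝ)| < 1 := by simpa [hA0] using hsmall
    have h2 : |B| < 1 := by exact_mod_cast h1
    rcases abs_lt.mp h2 with ⟨h3, h4⟩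
    omega
  have hz := hrank (fun i => (α i : ℚ)) (by rw [← hA]; simp [hA0]) hαw (by rw [← hB]; simp [hB0])
  apply hα
  funext i
  have hi := congrFun hz i
  simpa using hi

/-- THE SANDWICH LEMMA (contrapositive form). Under an irrationality-measure inequality for `ξ` with exponent
`κ ≥ 1` and constant `C > 0`, alignment `U`, decay `R` and the gap conditions `3 H R < 1`,
`3 H R < C (3 H U) ^ (1 - κ)`, there is NO nonzero integral relation `α ⊥ w` of height `≤ H`. With
`H = e^{τ n}`, `U = e^{u⊥ n}`, `R = e^{-c n}` the gap condition is `κ < 1 + (c - τ)/(τ + u⊥)` for large `n`. -/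
theorem no_short_relation_of_measure (ξ η : ℝ) (u w v : Fin 3 → ℚ) (r : Fin 3 → ℝ)
    (hr : ∀ i, r i = (u i : ℝ) * ξ + (w i : ℝ) * η + (v i : ℝ))
    (hrank : ∀ a : Fin 3 → ℚ, ∑ i, a i * u i = 0 → ∑ i, a i * w i = 0 → ∑ i, a i * v i = 0 → a = 0)
    (κ C : ℝ) (hκ : 1 ≤ κ) (hC : 0 < C)
    (hmeas : ∀ A B : ℤ, A ≠ 0 → C * |(A : ℝ)| ^ (1 - κ) ≤ |(A : ℝ) * ξ + (B : ℝ)|)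
    (lam U R H : ℝ) (hU : ∀ i, |(u i : ℝ) - lam * (w i : ℝ)| ≤ U) (hR : ∀ i, |r i| ≤ R)
    (hR1 : 3 * H * R < 1) (hgap : 3 * H * R < C * (3 * H * U) ^ (1 - κ))
    (α : Fin 3 → ℤ) (hα : α ≠ 0) (hαw : ∑ i, (α i : ℚ) * w i = 0)
    (hint : ∃ A B : ℤ, (A : ℚ) = ∑ i, (α i : ℚ) * u i ∧ (B : ℚ) = ∑ i, (α i : ℚ) * v i)
    (hH : ∀ i, |(α i : ℝ)| ≤ H) : False := by
  obtain ⟨A, B, hA, hB⟩ := hint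
  obtain ⟨hAle, hform⟩ := pair_of_short_relation ξ η u w v r hr α hαw A B hA hB lam U R H hH hU hR
  have hA0 : A ≠ 0 := pair_fst_ne_zero u w v hrank α hα hαw A B hA hB ξ (lt_of_le_of_lt hform hR1)
  have hm := hmeas A B hA0
  have hApos : (0 : ℝ) < |(A : ℝ)| := by
    have h1 : (1 : ℤ) ≤ |A| := Int.one_le_abs hA0
    have h2 : (1 : ℝ) ≤ |(A : ℝ)| := by exact_mod_cast h1
    linarith
  have hpow : (3 * H * U) ^ (1 - κ) ≤ |(A : ℝ)| ^ (1 - κ) :=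
    Real.rpow_le_rpow_of_nonpos hApos hAle (by linarith)
  have hchain : C * (3 * H * U) ^ (1 - κ) ≤ 3 * H * R :=
    le_trans (le_trans (mul_le_mul_of_nonneg_left hpow hC.le) hm) hform
  linarith

/-- The same statement as a LOWER BOUND FOR THE HEIGHT of every nonzero integral relation (`λ₁(M_n) > H` in the
sup-norm): under the hypotheses of `no_short_relation_of_measure`, some coordinate of `α` exceeds `H`. -/
theorem relation_height_gt_of_measure (ξ η : ℝ) (u w v : Fin 3 → ℚ) (r : Fin 3 → ℝ)
    (hr : ∀ i, r i = (u i : ℝ) * ξ + (w i : ℝ) * η + (v i : ℝ))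
    (hrank : ∀ a : Fin 3 → ℚ, ∑ i, a i * u i = 0 → ∑ i, a i * w i = 0 → ∑ i, a i * v i = 0 → a = 0)
    (κ C : ℝ) (hκ : 1 ≤ κ) (hC : 0 < C)
    (hmeas : ∀ A B : ℤ, A ≠ 0 → C * |(A : ℝ)| ^ (1 - κ) ≤ |(A : ℝ) * ξ + (B : ℝ)|)
    (lam U R H : ℝ) (hU : ∀ i, |(u i : ℝ) - lam * (w i : ℝ)| ≤ U) (hR : ∀ i, |r i| ≤ R)
    (hR1 : 3 * H * R < 1) (hgap : 3 * H * R < C * (3 * H * U) ^ (1 - κ))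
    (α : Fin 3 → ℤ) (hα : α ≠ 0) (hαw : ∑ i, (α i : ℚ) * w i = 0)
    (hint : ∃ A B : ℤ, (A : ℚ) = ∑ i, (α i : ℚ) * u i ∧ (B : ℚ) = ∑ i, (α i : ℚ) * v i) :
    ∃ i, H < |(α i : ℝ)| := by
  by_contra hcon
  push Not at hcon
  exact no_short_relation_of_measure ξ η u w v r hr hrank κ C hκ hC hmeas lam U R H hU hR hR1 hgap
    α hα hαw hint hcon

end Summit.KontsevichZagierPeriods.Zeta5Search.Elimination
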